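/-
Copyright (c) 2026 the pub-hodgecm-mathlib formalisation cell (harness21).  Prover seat hodgecm-mathlib-LH4-p13 (g6), req620 Track A «(D-RAM) FOUR-FRAME» squad, unit U2H:
the (ρ2b′-X) child `stub_U2H_fixedPointCensus_typeTwo_unit0` (U2H :418) — the two K♮-side SUPPLIERS `hH90` and `hsurjD` of ★ p857887 `F0P3cDyRamTopDepthRamK` (RamK top-depth law),
discharged in the ONE-FIELD RamK frame of ★ p857764 (a `Θ`-fixed unramified generator `αK`), the second under `[IsAdicComplete 𝓂[K] 𝒪[K]]`.  2026-09-04.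
-/
import Literature.NumberTheory.LocalFields.WildQuadraticDatumNormSurjective    -- ★ (LH4-p02): `map_eq_self_of_mul_self_eq` (Hensel roots of fixed elements are fixed); brings ★ `exists_mul_self_eq_of_valued_sub_one_lt_four`
import HarnessLib

/-!
# Crux `H413`, line LH4 «(D-RAM) FOUR-FRAME» — unit U2H, (ρ2b′-X): the K♮-side suppliers of the RamK top-depth law — Hilbert 90 with a unit, and norm surjectivity with depth

Cell `hodgecm-mathlib` (D-0151), FLOOR 0, crux item H413 = `stmt-HodgeConjecture-24833`; squad F0∕P3c∕LH4; registered stub served: `F0P3cDyRamFourFrameU2H.stub_U2H_fixedPointCensus_typeTwo_unit0`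
((ρ2b′-X), U2H :418) through LH4-p14's HEAD-OF-ORGANS, RK branch.  THEOREMS ONLY (no `def`, no instance, no notation, no `sorry`); lane `--supports stmt-HodgeConjecture-24833`.
★ p857887 `exists_topDecomp_iff_add_le` («some side alive at depth `s` ⟺ `s + d ≤ jλ + 1`») takes two K♮-side letters; both hold in the one-field RamK frame (`ρ, Θ` commuting, `ρ`
involutive isometric, `Θ` isometric, `αK` integral `Θ`-FIXED with `|αK − ραK| = 1` — the unramified third field `K♮ = Fix Θ = F(αK)`):
* §1 `exists_thetaFixed_unit_rho_eq_mul` = **`hH90`**: every `Θ`-fixed `x` with `xρx = 1` is `ρk∕k`-shaped: `ρk = x·k` for a `Θ`-fixed UNIT `k` — `k := c + ρx·ρc` with `c = 1`, or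
  `c = αK` when `x ≡ −1` (Hilbert 90 for the unramified `K♮∕F`, unit representative because `αK − ραK` is a unit).
* §2 `exists_thetaFixed_norm_near` ⇒ **`hsurjD`** (`[IsAdicComplete 𝓂[K] 𝒪[K]]`, `2 ≠ 0`): every `ρ`- and `Θ`-fixed `f` with `|f − 1| < 1` is `g·ρg` with `g` `Θ`-fixed and
  **`|g − 1| ≤ |f − 1|`** (Serre V §2 Prop. 3 a: `N(U^{(n)}_{K♮}) = U^{(n)}_F`, no loss of depth) — `g = 1 + y·a₀` with the INTEGRAL `Θ`-fixed `ρ`-trace-one element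
  `a₀ = −ραK∕(αK − ραK)`, `c = a₀ρa₀`, `y = (r − 1)∕(2c)`, `r² = 1 + 4(f − 1)c` the Hensel root near `1` (doubly fixed by ★ `map_eq_self_of_mul_self_eq`), `|y| = |f − 1|` — the
  unramified twin of ★ `WildQuadraticDatumNormSurjective.exists_mul_map_eq_of_fixed_of_v_sub_one_le` (same computation, integral `a₀` instead of the ramified `θ`);
  `hsurjD_of_frame` repackages it in ★ p857887's letter shape `∀ n f, 1 ≤ n → … → |f − 1| ≤ exp(−n) → ∃ g, Θg = g ∧ gρg = f ∧ |g − 1| ≤ exp(−n)`.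
The remaining letters of ★ p857887 ∕ p857901 are datum clauses or ★ one-field Literature on `(M, Θ, ϖE, d, t)`: `hNd` ← ★ `exists_mul_map_eq_of_isRamifiedQuadraticDatum`, `hdich` ← ★
`exists_unit_norm_dichotomy_of_isRamifiedQuadraticDatum`, the near-cell non-norm ← ★ `exists_fixed_unit_not_norm_of_level_pow`, `hNF` ← ★ `exists_mul_map_eq_of_fixed_fixed_of_isRamifiedQuadraticDatum`
with `hsurj :=` §2 at depth `0`-free form (or ★ `…_of_thirdField`).
HONEST LABEL.  Count-neutral helper; (ρ2b′-X) OPEN; `HC_CM` is proved only modulo the 7 printed citations (2 remaining named inputs: hLiu418 = `stmt-HodgeConjecture-24832`, h413 =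
`stmt-HodgeConjecture-24833`) until rung 0 closes.

## References
* [Serre1979] J.-P. Serre, *Local Fields*, GTM 67 (1979), Ch. V §2 Prop. 3; Ch. X §1; Ch. II §4 Prop. 7.
* [NeukirchANT1999] J. Neukirch, *Algebraic Number Theory*, Grundlehren 322 (1999), Ch. V (1.2)–(1.4).
-/

set_option autoImplicit false

open WithZero
open scoped Valued

namespace Summit.HodgeConjecture.HodgeConjecture.Cruxes.H413.F0P3cDyRamTopDepthRamKSuppliers

open Literature.NumberTheory.LocalFields.WildQuadraticDatum (map_eq_self_of_mul_self_eq)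
open Literature.NumberTheory.LocalFields (exists_mul_self_eq_of_valued_sub_one_lt_four)

variable {K : Type*} [Field K] [Valued K ℤᵐ⁰]

/-! ## §1 Hilbert 90 with a unit on the unramified third field (`hH90`) -/

/-- **`hH90`: a `Θ`-fixed `ρ`-norm-one `x` is `ρk = x·k` for a `Θ`-fixed UNIT `k`.**  `ρ` involutive isometric commuting with `Θ`; `αK` integral, `Θ`-fixed, `|αK − ραK| = 1`.  Take
`k := 1 + ρx`, or — when `|1 + ρx| < 1` — `k := αK + ρx·ραK = (αK − ραK) + (1 + ρx)·ραK`, a unit. [cite: Serre1979, Ch. X §1; Ch. V §2 Prop. 3] -/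
theorem exists_thetaFixed_unit_rho_eq_mul {ρ Θ : K →+* K} (hρρ : ∀ x, ρ (ρ x) = x) (hρΘ : ∀ x, ρ (Θ x) = Θ (ρ x))
    (hρv : ∀ x, Valued.v (ρ x) = Valued.v x)
    {αK : K} (hΘα : Θ αK = αK) (hα1 : Valued.v αK ≤ 1) (hαρ : Valued.v (αK - ρ αK) = 1)
    {x : K} (hΘx : Θ x = x) (hx : x * ρ x = 1) : ∃ k : K, Θ k = k ∧ Valued.v k = 1 ∧ ρ k = x * k := by
  have hvx : Valued.v x = 1 := by
    have h : Valued.v x * Valued.v x = 1 := by rw [← hρv x]; nth_rewrite 1 [hρv x]; rw [← Valuation.map_mul, hx, Valuation.map_one]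
    rcases lt_trichotomy (Valued.v x) 1 with h1 | h1 | h1
    · exfalso
      have hlt : Valued.v x * Valued.v x < 1 :=
        calc Valued.v x * Valued.v x ≤ Valued.v x * 1 := by gcongr
          _ < 1 := by rw [mul_one]; exact h1
      rw [h] at hlt; exact lt_irrefl _ hlt
    · exact h1
    · exfalso
      have hlt : 1 < Valued.v x * Valued.v x :=
        calc (1 : ℤᵐ⁰) < Valued.v x := h1
          _ = Valued.v x * 1 := (mul_one _).symm
          _ ≤ Valued.v x * Valued.v x := by gcongr
      rw [h] at hlt; exact lt_irrefl _ hlt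
  have hΘρx : Θ (ρ x) = ρ x := by rw [← hρΘ, hΘx]
  have hle : Valued.v (1 + ρ x) ≤ 1 := (Valuation.map_add _ _ _).trans (max_le (by rw [Valuation.map_one]) (by rw [hρv, hvx]))
  by_cases h1 : Valued.v (1 + ρ x) = 1
  · refine ⟨1 + ρ x, by rw [map_add, map_one, hΘρx], h1, ?_⟩
    rw [map_add, map_one, hρρ]
    linear_combination -hx
  · have hlt : Valued.v (1 + ρ x) < 1 := lt_of_le_of_ne hle h1
    refine ⟨αK + ρ x * ρ αK, ?_, ?_, ?_⟩
    · rw [map_add, map_mul, hΘα, hΘρx, ← hρΘ, hΘα]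
    · have h2 : αK + ρ x * ρ αK = (αK - ρ αK) + (1 + ρ x) * ρ αK := by ring
      rw [h2, Valuation.map_add_eq_of_lt_left _ ?_, hαρ]
      rw [hαρ, Valuation.map_mul, hρv]
      calc Valued.v (1 + ρ x) * Valued.v αK ≤ Valued.v (1 + ρ x) * 1 := by gcongr
        _ < 1 := by rw [mul_one]; exact hlt
    · rw [map_add, map_mul, hρρ, hρρ]
      linear_combination (-(ρ αK)) * hx

/-! ## §2 Norm surjectivity with depth on the unramified third field (`hsurjD`) -/

/-- **UNRAMIFIED NORM SURJECTIVITY WITHOUT LOSS OF DEPTH** (`[IsAdicComplete 𝓂[K] 𝒪[K]]`, `2 ≠ 0`): `ρ` involutive isometric, `Θ` isometric, commuting; `αK` integral `Θ`-fixed with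
`|αK − ραK| = 1`.  Every `ρ`- and `Θ`-fixed `f` with `|f − 1| < 1` is `g·ρg` with `Θg = g` and `|g − 1| ≤ |f − 1|`: `g = 1 + y·a₀`, `a₀ = −ραK∕(αK − ραK)` (integral, `Θ`-fixed,
`a₀ + ρa₀ = 1`), `c = a₀ρa₀`, `r² = 1 + 4(f − 1)c` (Hensel, `r` doubly fixed ★), `y = (r − 1)∕(2c)`, `cy² + y = f − 1`, `|y| = |f − 1|`. [cite: Serre1979, Ch. V §2 Prop. 3; Ch. II §4 Prop. 7]
[cite: NeukirchANT1999, Ch. V (1.2)] -/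
theorem exists_thetaFixed_norm_near [IsAdicComplete 𝓂[K] 𝒪[K]] {ρ Θ : K →+* K} (hρρ : ∀ x, ρ (ρ x) = x) (hρΘ : ∀ x, ρ (Θ x) = Θ (ρ x))
    (hρv : ∀ x, Valued.v (ρ x) = Valued.v x) (hΘv : ∀ x, Valued.v (Θ x) = Valued.v x) (h20 : (2 : K) ≠ 0)
    {αK : K} (hΘα : Θ αK = αK) (hα1 : Valued.v αK ≤ 1) (hαρ : Valued.v (αK - ρ αK) = 1)
    {f : K} (hρf : ρ f = f) (hΘf : Θ f = f) (hf1 : Valued.v (f - 1) < 1) :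
    ∃ g : K, Θ g = g ∧ g * ρ g = f ∧ Valued.v (g - 1) ≤ Valued.v (f - 1) := by
  have hv20 : Valued.v (2 : K) ≠ 0 := (Valuation.ne_zero_iff _).2 h20
  have h40 : (4 : K) ≠ 0 := by rw [show (4 : K) = 2 * 2 by norm_num]; exact mul_ne_zero h20 h20
  have hρ2 : ρ 2 = 2 := map_ofNat ρ 2
  have hρ4 : ρ 4 = 4 := map_ofNat ρ 4
  have hΘ2 : Θ 2 = 2 := map_ofNat Θ 2
  have hΘ4 : Θ 4 = 4 := map_ofNat Θ 4
  -- ## the integral `Θ`-fixed `ρ`-trace-one element `a₀` and `c = a₀ρa₀`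
  have hδ0 : αK - ρ αK ≠ 0 := fun h0 => by rw [h0, map_zero] at hαρ; exact zero_ne_one hαρ
  set a₀ := -ρ αK / (αK - ρ αK) with ha₀
  have ha₀tr : a₀ + ρ a₀ = 1 := by
    have hδ0' : ρ αK - αK ≠ 0 := fun h0 => hδ0 (by linear_combination (-1 : K) * h0)
    rw [ha₀, map_div₀, map_neg, map_sub, hρρ]
    field_simp
    ring
  have ha₀v : Valued.v a₀ ≤ 1 := by rw [ha₀, map_div₀, Valuation.map_neg, hρv, hαρ, div_one]; exact hα1
  have hΘa₀ : Θ a₀ = a₀ := by rw [ha₀, map_div₀, map_neg, map_sub, hΘα, ← hρΘ, hΘα]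
  have ha₀0 : a₀ ≠ 0 := by
    intro h0
    rw [h0, map_zero, zero_add] at ha₀tr
    exact zero_ne_one ha₀tr
  set c : K := a₀ * ρ a₀ with hc
  have hρc : ρ c = c := by rw [hc, map_mul, hρρ, mul_comm]
  have hΘc : Θ c = c := by rw [hc, map_mul, ← hρΘ, hΘa₀]
  have hc0 : c ≠ 0 := mul_ne_zero ha₀0 ((map_ne_zero ρ).2 ha₀0)
  have hvc1 : Valued.v c ≤ 1 := by rw [hc, Valuation.map_mul, hρv]; exact mul_le_one' ha₀v ha₀v
  have hvc0 : Valued.v c ≠ 0 := (Valuation.ne_zero_iff _).2 hc0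
  -- ## `a = f − 1`, `s = 1 + 4ac`, the Hensel root `r`
  set a : K := f - 1 with ha
  have hρa : ρ a = a := by rw [ha, map_sub, hρf, map_one]
  have hΘa : Θ a = a := by rw [ha, map_sub, hΘf, map_one]
  set s : K := 1 + 4 * a * c with hs
  have hρs : ρ s = s := by rw [hs, map_add, map_one, map_mul, map_mul, hρ4, hρa, hρc]
  have hΘs : Θ s = s := by rw [hs, map_add, map_one, map_mul, map_mul, hΘ4, hΘa, hΘc]
  have hs1 : Valued.v (s - 1) < Valued.v (4 : K) := by
    rw [hs, add_sub_cancel_left, mul_assoc, Valuation.map_mul]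
    have hac : Valued.v (a * c) < 1 := by
      rw [Valuation.map_mul]
      calc Valued.v a * Valued.v c ≤ Valued.v a * 1 := mul_le_mul' le_rfl hvc1
        _ < 1 := by rw [mul_one]; exact hf1
    calc Valued.v (4 : K) * Valued.v (a * c) < Valued.v (4 : K) * 1 :=
          mul_lt_mul_of_pos_left hac (zero_lt_iff.2 ((Valuation.ne_zero_iff _).2 h40))
      _ = Valued.v (4 : K) := mul_one _
  obtain ⟨r, hrr, hr1⟩ := exists_mul_self_eq_of_valued_sub_one_lt_four s hs1
  have hρr : ρ r = r := map_eq_self_of_mul_self_eq hρv hρs hrr hr1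
  have hΘr : Θ r = r := map_eq_self_of_mul_self_eq hΘv hΘs hrr hr1
  -- ## `y = (r − 1)∕(2c)` solves `cy² + y = a`
  set y : K := (r - 1) / (2 * c) with hy
  have hρy : ρ y = y := by rw [hy, map_div₀, map_sub, hρr, map_one, map_mul, hρ2, hρc]
  have hΘy : Θ y = y := by rw [hy, map_div₀, map_sub, hΘr, map_one, map_mul, hΘ2, hΘc]
  have hquad : c * (y * y) + y = a := by
    have h1 : 2 * c * y = r - 1 := by rw [hy]; field_simp
    have h2 : (2 * c * y + 1) * (2 * c * y + 1) = 1 + 4 * a * c := by rw [h1, sub_add_cancel, hrr]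
    have h3 : 4 * c * (c * (y * y) + y) = 4 * c * a := by linear_combination h2
    exact mul_left_cancel₀ (mul_ne_zero h40 hc0) h3
  -- ## `g = 1 + y·a₀`
  refine ⟨1 + y * a₀, by rw [map_add, map_one, map_mul, hΘy, hΘa₀], ?_, ?_⟩
  · have h : (1 + y * a₀) * ρ (1 + y * a₀) = 1 + y * (a₀ + ρ a₀) + c * (y * y) := by rw [map_add, map_one, map_mul, hρy, hc]; ring
    rw [h, ha₀tr, mul_one, add_assoc, add_comm y, hquad, ha, add_sub_cancel]
  · -- `|g − 1| = |y|·|a₀| ≤ |y| = |a|`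
    have hrp1 : Valued.v (r + 1) = Valued.v (2 : K) := by
      rw [show r + 1 = 2 + (r - 1) by ring]; exact Valuation.map_add_eq_of_lt_left _ hr1
    have hvy : Valued.v y = Valued.v a := by
      have h1 : Valued.v ((r - 1) * (r + 1)) = Valued.v (4 * a * c) := by
        rw [show (r - 1) * (r + 1) = r * r - 1 by ring, hrr, hs, add_sub_cancel_left]
      rw [Valuation.map_mul, Valuation.map_mul, Valuation.map_mul] at h1
      have h2 : Valued.v y * (Valued.v (2 : K) * Valued.v c) = Valued.v (r - 1) := by
        rw [hy, map_div₀, Valuation.map_mul, div_mul_cancel₀ _ (mul_ne_zero hv20 hvc0)]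
      have h4 : Valued.v (4 : K) = Valued.v (2 : K) * Valued.v (2 : K) := by rw [show (4 : K) = 2 * 2 by norm_num, Valuation.map_mul]
      have h3 : Valued.v y * (Valued.v (2 : K) * Valued.v c * Valued.v (2 : K)) = Valued.v a * (Valued.v (2 : K) * Valued.v c * Valued.v (2 : K)) :=
        calc Valued.v y * (Valued.v (2 : K) * Valued.v c * Valued.v (2 : K)) = Valued.v y * (Valued.v (2 : K) * Valued.v c) * Valued.v (r + 1) := by rw [hrp1]; ac_rfl
          _ = Valued.v (r - 1) * Valued.v (r + 1) := by rw [h2]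
          _ = Valued.v (4 : K) * Valued.v a * Valued.v c := h1
          _ = Valued.v a * (Valued.v (2 : K) * Valued.v c * Valued.v (2 : K)) := by rw [h4]; ac_rfl
      exact mul_right_cancel₀ (mul_ne_zero (mul_ne_zero hv20 hvc0) hv20) h3
    rw [add_sub_cancel_left, Valuation.map_mul, hvy]
    calc Valued.v a * Valued.v a₀ ≤ Valued.v a * 1 := mul_le_mul' le_rfl ha₀v
      _ = Valued.v a := mul_one _

/-- **`hsurjD` IN THE LETTER SHAPE OF ★ p857887** (`exists_thetaFixed_normOne_near_ramK` ∕ `exists_topDecomp_iff_add_le`): for every `n ≥ 1`, every `ρ`- and `Θ`-fixed `f` with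
`|f − 1| ≤ exp(−n)` is `gρg` with `Θg = g` and `|g − 1| ≤ exp(−n)`. [cite: Serre1979, Ch. V §2 Prop. 3] -/
theorem hsurjD_of_frame [IsAdicComplete 𝓂[K] 𝒪[K]] {ρ Θ : K →+* K} (hρρ : ∀ x, ρ (ρ x) = x) (hρΘ : ∀ x, ρ (Θ x) = Θ (ρ x))
    (hρv : ∀ x, Valued.v (ρ x) = Valued.v x) (hΘv : ∀ x, Valued.v (Θ x) = Valued.v x) (h20 : (2 : K) ≠ 0)
    {αK : K} (hΘα : Θ αK = αK) (hα1 : Valued.v αK ≤ 1) (hαρ : Valued.v (αK - ρ αK) = 1) :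
    ∀ (n : ℕ) (f : K), 1 ≤ n → ρ f = f → Θ f = f → Valued.v (f - 1) ≤ exp (-(n : ℤ)) →
      ∃ g : K, Θ g = g ∧ g * ρ g = f ∧ Valued.v (g - 1) ≤ exp (-(n : ℤ)) := by
  intro n f hn hρf hΘf hf
  have hf1 : Valued.v (f - 1) < 1 := lt_of_le_of_lt hf (by rw [← exp_zero, exp_lt_exp]; omega)
  obtain ⟨g, hΘg, hgg, hg1⟩ := exists_thetaFixed_norm_near hρρ hρΘ hρv hΘv h20 hΘα hα1 hαρ hρf hΘf hf1
  exact ⟨g, hΘg, hgg, hg1.trans hf⟩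

end Summit.HodgeConjecture.HodgeConjecture.Cruxes.H413.F0P3cDyRamTopDepthRamKSuppliers
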